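import Summits.Ventures.CertifiedManyBodySolver.Observables.WardBogoliubovBorder
import Literature.MathematicalPhysics.QuantumLattice.DWaveSourceNNNHoppingOrderParameter
import Literature.MathematicalPhysics.QuantumLattice.DWaveKomaTasakiSystem
import HarnessLib

/-!
# The Ward–Bogoliubov border in the TRACIAL ground state (the state behind `dWaveSourceDensityTT'`), and the
# `d`-wave pair-sourced torus instance: a border FLOOR on `m_L(h)`

Sequel of `WardBogoliubovBorder.lean` (vector ground states). Cell `hubbard-cq`, lead ASSIGN 2026-08-26T23:21Z to
seat `hubbard-cq-p1`; statement `WBFunctional` of transplant-2 g2's `WardBogoliubovSketch-transplant2.lean`.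

* §4 `posSemidef_doubleCommutatorBlock_groundStateFunctional`: for Hermitian `H` and ANY finite matrix family `X`,
  the block `D_ab = ω₀((X a)ᴴ[H, X b] − [H, X b](X a)ᴴ)` of the TRACIAL ground-state functional
  `ω₀ = Matrix.groundStateFunctional H` (uniform mixture of ALL ground states — no uniqueness hypothesis) is
  `PosSemidef`: its quadratic form at `c` is `ω₀(Zᴴ[H,Z]) + ω₀(Z[H,Zᴴ]ᵀ…) = ω₀(Zᴴ[H,Z]) + ω₀((Zᴴ)ᴴ[H,Zᴴ]) ≥ 0`,
  `Z = Σ c_b X_b` (two second-order rows, `groundStateFunctional_conjTranspose_comm_mul_nonneg`, the cross term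
  being a first-order row `ω₀([H,·]) = 0`), and it is Hermitian by the same first-order rows.
* §4 `ward_bogoliubov_groundStateFunctional` (WBFunctional): `h·‖ω_h([P,Y])‖² ≤ Re ω_h(O) · Re ω_h([Yᴴ,[A(h),Y]])`
  for `A(h) = K − h(Δ + Δᴴ)`, `KG = GK`, `GΔ − ΔG = −Δ`, `O = Δ + Δᴴ`, `P = i(Δ − Δᴴ)`, `0 < h`, and the floor
  form `re_groundStateFunctional_source_ge_of_ward_bogoliubov`.
* §5 TREE UNITS (`dWaveSourceTorusTT' L t' U μ h = K − h·(Δ_d + Δ_dᴴ)`, `K = H_L(1,t',U) − μN`, `G = N/2`,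
  `[K, N] = 0`, `Δ_d N = NΔ_d + 2Δ_d` ⇒ `GΔ_d − Δ_dG = −Δ_d`; `Re ω_h(Δ_d + Δ_dᴴ) = 2L²·m_L(h)`):
  `ward_bogoliubov_dWaveSourceTorusTT'` — for every matrix `Y` on the torus Fock space and `0 < h`,
  `h·‖ω_h([i(Δ_d − Δ_dᴴ), Y])‖² ≤ 2L²·m_L(h) · Re ω_h([Yᴴ,[A_L(h),Y]])`, and the BORDER FLOOR
  `dWaveSourceDensityTT'_ge_of_ward_bogoliubov`: certified `0 < c ≤ ‖ω_h([Δ_d − Δ_dᴴ, Y])‖` (torque) and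
  `Re ω_h([Yᴴ,[A_L(h),Y]]) ≤ d` give `h·c²/(2L²·d) ≤ m_L(h)`.

Certificate-side status (transplant-2's question, see the prequel's docstring): the torus-level soundness for a border
block with the torus-wide generator `N/2` is THIS file; what a p471916-type window certificate still needs is the
«zero-momentum dcomm hook» expressing `L⁻²ω_h([X(0)ᴴ,[A_L,Y(0)]])` by window words (locality + translation
invariance). HONEST FRAMING: rows valid in every (tracial) ground state of the SOURCED problem at fixed `h > 0`; a
finite-`h` response floor fed by certified torque/row data is a T1 / W1 object, not an order parameter, not a phase
word; nothing here is a number. No definition, no named fact, no `sorry`.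

References: L. Pitaevskii, S. Stringari, J. Low Temp. Phys. 85 (1991) 377, §2 [PitaevskiiStringari1991]; H. Wagner,
Z. Physik 195 (1966) 273, §II [Wagner1966]; O. Bratteli, D. W. Robinson, Operator Algebras and Quantum Statistical
Mechanics II (1997), Prop. 5.3.19 [BratteliRobinsonII1997]; T. Koma, H. Tasaki, J. Stat. Phys. 76 (1994) 745, (2.16)
[KomaTasaki1994].
-/

noncomputable section

namespace Summit.Ventures.CertifiedManyBodySolver.Observables

open Matrix Literature.MathematicalPhysics.QuantumLattice
open scoped ComplexOrder

variable {n : Type*} [Fintype n] [DecidableEq n]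

/-! ### §4 The tracial ground-state functional: block positivity and the border inequality -/

section Tracial

variable {H : Matrix n n ℂ}

omit [DecidableEq n] in
/-- Sesquilinear expansion of the double commutator: with `Z = Σ_b c_b X_b`,
`Zᴴ[H,Z] − [H,Z]Zᴴ = Σ_a Σ_b (c̄_a c_b) • ((X a)ᴴ[H,X b] − [H,X b](X a)ᴴ)`. [folklore] -/
private theorem doubleCommutator_sum_smul {m : Type*} [Fintype m] (X : m → Matrix n n ℂ) (c : m → ℂ) :
    (∑ b, c b • X b)ᴴ * (H * (∑ b, c b • X b) - (∑ b, c b • X b) * H) -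
        (H * (∑ b, c b • X b) - (∑ b, c b • X b) * H) * (∑ b, c b • X b)ᴴ =
      ∑ a, ∑ b, (star (c a) * c b) • ((X a)ᴴ * (H * X b - X b * H) - (H * X b - X b * H) * (X a)ᴴ) := by
  have hT : H * (∑ b, c b • X b) - (∑ b, c b • X b) * H = ∑ b, c b • (H * X b - X b * H) := by
    rw [Finset.mul_sum, Finset.sum_mul, ← Finset.sum_sub_distrib]
    refine Finset.sum_congr rfl fun b _ => ?_
    rw [Matrix.mul_smul, Matrix.smul_mul, smul_sub]
  have hZ : (∑ b, c b • X b)ᴴ = ∑ a, star (c a) • (X a)ᴴ := by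
    rw [conjTranspose_sum]
    exact Finset.sum_congr rfl fun a _ => conjTranspose_smul _ _
  rw [hT, hZ, Finset.sum_mul, Finset.mul_sum, ← Finset.sum_sub_distrib]
  refine Finset.sum_congr rfl fun a _ => ?_
  rw [Finset.mul_sum, Finset.sum_mul, ← Finset.sum_sub_distrib]
  refine Finset.sum_congr rfl fun b _ => ?_
  rw [Matrix.smul_mul, Matrix.mul_smul, Matrix.mul_smul, Matrix.smul_mul, smul_smul, smul_smul, ← smul_sub]

/-- The tracial second-order row for the MIRRORED order: `ω₀(−[H,Z]Zᴴ) = ω₀((Zᴴ)ᴴ[H,Zᴴ])` (the two differ by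
the first-order row `ω₀([H, ZZᴴ]) = 0`). [cite: BratteliRobinsonII1997, Prop. 5.3.19] -/
theorem groundStateFunctional_neg_comm_mul_conjTranspose (hH : H.IsHermitian) (Z : Matrix n n ℂ) :
    H.groundStateFunctional (-((H * Z - Z * H) * Zᴴ)) = H.groundStateFunctional ((Zᴴ)ᴴ * (H * Zᴴ - Zᴴ * H)) := by
  have e : -((H * Z - Z * H) * Zᴴ) = (Zᴴ)ᴴ * (H * Zᴴ - Zᴴ * H) - (H * (Z * Zᴴ) - (Z * Zᴴ) * H) := by
    rw [conjTranspose_conjTranspose]; noncomm_ring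
  rw [e, map_sub, groundStateFunctional_comm_eq_zero hH, sub_zero]

/-- The tracial double-commutator entry under `ᴴ`: `ω₀(D(X,Y))⋆ = ω₀(D(Y,X))`, `D(X,Y) = Xᴴ[H,Y] − [H,Y]Xᴴ`
(the operators `D(Y,X)ᴴ` and `D(X,Y)` differ by two commutators with `H`). [cite: BratteliRobinsonII1997, Prop. 5.3.19] -/
theorem star_groundStateFunctional_doubleCommutator (hH : H.IsHermitian) (X Y : Matrix n n ℂ) :
    star (H.groundStateFunctional (Yᴴ * (H * X - X * H) - (H * X - X * H) * Yᴴ)) =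
      H.groundStateFunctional (Xᴴ * (H * Y - Y * H) - (H * Y - Y * H) * Xᴴ) := by
  rw [← groundStateFunctional_conjTranspose]
  have e : (Yᴴ * (H * X - X * H) - (H * X - X * H) * Yᴴ)ᴴ =
      (Xᴴ * (H * Y - Y * H) - (H * Y - Y * H) * Xᴴ) +
        ((H * (Y * Xᴴ) - (Y * Xᴴ) * H) - (H * (Xᴴ * Y) - (Xᴴ * Y) * H)) := by
    simp only [conjTranspose_sub, conjTranspose_mul, conjTranspose_conjTranspose, hH.eq]
    noncomm_ring
  have hz : H.groundStateFunctional ((H * (Y * Xᴴ) - Y * Xᴴ * H) - (H * (Xᴴ * Y) - Xᴴ * Y * H)) = 0 := by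
    rw [map_sub, groundStateFunctional_comm_eq_zero hH, groundStateFunctional_comm_eq_zero hH, sub_zero]
  rw [e, map_add, hz, add_zero]

/-- **(DCommBlockPSD, tracial) The `k = 0` double-commutator block of the TRACIAL ground state is positive
semidefinite** — for Hermitian `H` and any finite matrix family `X`, with `ω₀ = Matrix.groundStateFunctional H`
(uniform mixture of all ground states; no uniqueness or gap hypothesis):
`(ω₀((X a)ᴴ[H,X b] − [H,X b](X a)ᴴ))_{ab} ⪰ 0`. [cite: PitaevskiiStringari1991, §2] [cite: BratteliRobinsonII1997, Prop. 5.3.19] -/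
theorem posSemidef_doubleCommutatorBlock_groundStateFunctional (hH : H.IsHermitian) {m : Type*} [Fintype m]
    (X : m → Matrix n n ℂ) :
    (Matrix.of fun a b : m =>
      H.groundStateFunctional ((X a)ᴴ * (H * X b - X b * H) - (H * X b - X b * H) * (X a)ᴴ)).PosSemidef := by
  classical
  refine PosSemidef.of_dotProduct_mulVec_nonneg ?_ fun c => ?_
  · refine Matrix.IsHermitian.ext fun a b => ?_
    rw [Matrix.of_apply, Matrix.of_apply]
    exact star_groundStateFunctional_doubleCommutator hH (X a) (X b)
  · -- the quadratic form is `ω₀(Zᴴ[H,Z]) + ω₀((Zᴴ)ᴴ[H,Zᴴ])`, `Z = Σ c_b X_b`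
    set Z : Matrix n n ℂ := ∑ b, c b • X b with hZ
    have hq : star c ⬝ᵥ (Matrix.of fun a b : m =>
        H.groundStateFunctional ((X a)ᴴ * (H * X b - X b * H) - (H * X b - X b * H) * (X a)ᴴ)) *ᵥ c =
        H.groundStateFunctional (Zᴴ * (H * Z - Z * H) - (H * Z - Z * H) * Zᴴ) := by
      rw [hZ, doubleCommutator_sum_smul, map_sum]
      simp only [dotProduct, mulVec, Matrix.of_apply, Pi.star_apply, Finset.mul_sum, map_sum, map_smul,
        smul_eq_mul]
      refine Finset.sum_congr rfl fun a _ => Finset.sum_congr rfl fun b _ => ?_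
      ring
    rw [hq, map_sub, sub_eq_add_neg, ← map_neg, groundStateFunctional_neg_comm_mul_conjTranspose hH]
    exact add_nonneg (groundStateFunctional_conjTranspose_comm_mul_nonneg hH Z)
      (groundStateFunctional_conjTranspose_comm_mul_nonneg hH Zᴴ)

/-- Diagonal tracial row: `0 ≤ Re ω₀(Yᴴ[H,Y] − [H,Y]Yᴴ)`. [cite: BratteliRobinsonII1997, Prop. 5.3.19] -/
theorem re_groundStateFunctional_doubleCommutator_nonneg (hH : H.IsHermitian) (Y : Matrix n n ℂ) :
    0 ≤ (H.groundStateFunctional (Yᴴ * (H * Y - Y * H) - (H * Y - Y * H) * Yᴴ)).re := by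
  have h := (posSemidef_doubleCommutatorBlock_groundStateFunctional hH (fun _ : Fin 1 => Y)).diag_nonneg (i := 0)
  rw [Matrix.of_apply] at h
  exact (Complex.nonneg_iff.1 h).1

/-- `2 × 2` positive semidefinite data over `ℂ`: `‖M 0 1‖² ≤ Re M 0 0 · Re M 1 1`. [folklore] -/
theorem norm_sq_le_re_mul_re_of_posSemidef_fin_two {M : Matrix (Fin 2) (Fin 2) ℂ} (hM : M.PosSemidef) :
    ‖M 0 1‖ ^ 2 ≤ (M 0 0).re * (M 1 1).re := by
  have hdet := hM.det_nonneg
  rw [det_fin_two] at hdet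
  have h10 : M 1 0 = star (M 0 1) := (hM.isHermitian.apply 1 0).symm
  have h00 : M 0 0 = ((M 0 0).re : ℂ) := by
    have := hM.diag_nonneg (i := 0)
    apply Complex.ext <;> simp [(Complex.nonneg_iff.1 this).2.symm]
  have h11 : M 1 1 = ((M 1 1).re : ℂ) := by
    have := hM.diag_nonneg (i := 1)
    apply Complex.ext <;> simp [(Complex.nonneg_iff.1 this).2.symm]
  rw [h10, Complex.star_def, Complex.mul_conj, Complex.normSq_eq_norm_sq] at hdet
  rw [h00, h11] at hdet
  have := (Complex.nonneg_iff.1 hdet).1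
  simp only [Complex.sub_re, Complex.mul_re, Complex.ofReal_re, Complex.ofReal_im, mul_zero, sub_zero] at this
  linarith

variable {K G Δ : Matrix n n ℂ}

/-- **(WBFunctional) The Ward–Bogoliubov border inequality in the TRACIAL ground state of the sourced matrix.**
`K`, `G` Hermitian, `KG = GK`, `GΔ − ΔG = −Δ`, `0 < h`, `ω_h` the tracial ground-state functional of
`A(h) = K − h(Δ + Δᴴ)`; for EVERY matrix `Y`:
`h·‖ω_h((Δ − Δᴴ)Y − Y(Δ − Δᴴ))‖² ≤ Re ω_h(Δ + Δᴴ) · Re ω_h(Yᴴ[A(h),Y] − [A(h),Y]Yᴴ)`.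
[cite: PitaevskiiStringari1991, §2] [cite: Wagner1966, §II] -/
theorem ward_bogoliubov_groundStateFunctional (hK : K.IsHermitian) (hG : G.IsHermitian) (hKG : K * G = G * K)
    (hch : G * Δ - Δ * G = -Δ) {h : ℝ} (hh : 0 < h) (Y : Matrix n n ℂ) :
    h * ‖(K - (h : ℂ) • (Δ + Δᴴ)).groundStateFunctional ((Δ - Δᴴ) * Y - Y * (Δ - Δᴴ))‖ ^ 2 ≤
      ((K - (h : ℂ) • (Δ + Δᴴ)).groundStateFunctional (Δ + Δᴴ)).re *
        ((K - (h : ℂ) • (Δ + Δᴴ)).groundStateFunctional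
          (Yᴴ * ((K - (h : ℂ) • (Δ + Δᴴ)) * Y - Y * (K - (h : ℂ) • (Δ + Δᴴ))) -
            ((K - (h : ℂ) • (Δ + Δᴴ)) * Y - Y * (K - (h : ℂ) • (Δ + Δᴴ))) * Yᴴ)).re := by
  set A : Matrix n n ℂ := K - (h : ℂ) • (Δ + Δᴴ) with hA
  have hAh : A.IsHermitian := by
    rw [hA]
    refine hK.sub (IsHermitian.smul (isHermitian_add_transpose_self Δ) ?_)
    rw [isSelfAdjoint_iff, Complex.star_def, Complex.conj_ofReal]
  set X : Fin 2 → Matrix n n ℂ := ![G, Y] with hX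
  have hblock := posSemidef_doubleCommutatorBlock_groundStateFunctional hAh X
  have hineq := norm_sq_le_re_mul_re_of_posSemidef_fin_two hblock
  simp only [Matrix.of_apply, hX, Matrix.cons_val_zero, Matrix.cons_val_one] at hineq
  have hGG : A.groundStateFunctional (Gᴴ * (A * G - G * A) - (A * G - G * A) * Gᴴ) =
      (h : ℂ) * A.groundStateFunctional (Δ + Δᴴ) := by
    rw [hG.eq, hA, ward_doubleCommutator hG hKG hch h, LinearMap.map_smul_of_tower, smul_eq_mul]
  have hGY : A.groundStateFunctional (Gᴴ * (A * Y - Y * A) - (A * Y - Y * A) * Gᴴ) =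
      (h : ℂ) * A.groundStateFunctional ((Δ - Δᴴ) * Y - Y * (Δ - Δᴴ)) := by
    have hcomm := sourced_comm_charge hG hKG hch h
    rw [← hA] at hcomm
    have hGA : G * A - A * G = (h : ℂ) • (Δ - Δᴴ) := by
      rw [← neg_sub, hcomm, neg_neg]
    have hjac : Gᴴ * (A * Y - Y * A) - (A * Y - Y * A) * Gᴴ =
        ((G * A - A * G) * Y - Y * (G * A - A * G)) + (A * (G * Y - Y * G) - (G * Y - Y * G) * A) := by
      rw [hG.eq]; noncomm_ring
    rw [hjac, map_add, groundStateFunctional_comm_eq_zero hAh, add_zero, hGA, Matrix.smul_mul, Matrix.mul_smul,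
      ← smul_sub, LinearMap.map_smul_of_tower, smul_eq_mul]
  rw [hGG, hGY, norm_mul, mul_pow, Complex.norm_real, Real.norm_eq_abs, abs_of_pos hh, Complex.re_ofReal_mul]
    at hineq
  have key : h * (h * ‖A.groundStateFunctional ((Δ - Δᴴ) * Y - Y * (Δ - Δᴴ))‖ ^ 2) ≤
      h * ((A.groundStateFunctional (Δ + Δᴴ)).re *
        (A.groundStateFunctional (Yᴴ * (A * Y - Y * A) - (A * Y - Y * A) * Yᴴ)).re) := by
    have e1 : h * (h * ‖A.groundStateFunctional ((Δ - Δᴴ) * Y - Y * (Δ - Δᴴ))‖ ^ 2) =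
        h ^ 2 * ‖A.groundStateFunctional ((Δ - Δᴴ) * Y - Y * (Δ - Δᴴ))‖ ^ 2 := by ring
    rw [e1, ← mul_assoc]
    exact hineq
  exact le_of_mul_le_mul_left key hh

/-- Rotated-source form, verbatim transplant-2's `WBFunctional`: `h‖ω_h([i(Δ − Δᴴ), Y])‖² ≤ Re ω_h(O)·Re ω_h([Yᴴ,[A,Y]])`.
[cite: PitaevskiiStringari1991, §2] -/
theorem ward_bogoliubov_groundStateFunctional_rotated (hK : K.IsHermitian) (hG : G.IsHermitian)
    (hKG : K * G = G * K) (hch : G * Δ - Δ * G = -Δ) {h : ℝ} (hh : 0 < h) (Y : Matrix n n ℂ) :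
    h * ‖(K - (h : ℂ) • (Δ + Δᴴ)).groundStateFunctional
        ((Complex.I • (Δ - Δᴴ)) * Y - Y * (Complex.I • (Δ - Δᴴ)))‖ ^ 2 ≤
      ((K - (h : ℂ) • (Δ + Δᴴ)).groundStateFunctional (Δ + Δᴴ)).re *
        ((K - (h : ℂ) • (Δ + Δᴴ)).groundStateFunctional
          (Yᴴ * ((K - (h : ℂ) • (Δ + Δᴴ)) * Y - Y * (K - (h : ℂ) • (Δ + Δᴴ))) -
            ((K - (h : ℂ) • (Δ + Δᴴ)) * Y - Y * (K - (h : ℂ) • (Δ + Δᴴ))) * Yᴴ)).re := by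
  have e : (Complex.I • (Δ - Δᴴ)) * Y - Y * (Complex.I • (Δ - Δᴴ)) =
      Complex.I • ((Δ - Δᴴ) * Y - Y * (Δ - Δᴴ)) := by
    rw [Matrix.smul_mul, Matrix.mul_smul, smul_sub]
  rw [e, map_smul, smul_eq_mul, norm_mul, Complex.norm_I, one_mul]
  exact ward_bogoliubov_groundStateFunctional hK hG hKG hch hh Y

/-- **Border FLOOR, tracial form**: a certified strictly positive torque `0 < c ≤ ‖ω_h([Δ − Δᴴ, Y])‖` and a certified
`Y`-row ceiling `Re ω_h([Yᴴ,[A,Y]]) ≤ d`, `0 < d`, give `h·c²/d ≤ Re ω_h(Δ + Δᴴ)`.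
[cite: PitaevskiiStringari1991, §2] -/
theorem re_groundStateFunctional_source_ge_of_ward_bogoliubov (hK : K.IsHermitian) (hG : G.IsHermitian)
    (hKG : K * G = G * K) (hch : G * Δ - Δ * G = -Δ) {h : ℝ} (hh : 0 < h) (Y : Matrix n n ℂ) {c d : ℝ}
    (hc : 0 < c) (hcle : c ≤ ‖(K - (h : ℂ) • (Δ + Δᴴ)).groundStateFunctional ((Δ - Δᴴ) * Y - Y * (Δ - Δᴴ))‖)
    (hd : 0 < d)
    (hdle : ((K - (h : ℂ) • (Δ + Δᴴ)).groundStateFunctional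
          (Yᴴ * ((K - (h : ℂ) • (Δ + Δᴴ)) * Y - Y * (K - (h : ℂ) • (Δ + Δᴴ))) -
            ((K - (h : ℂ) • (Δ + Δᴴ)) * Y - Y * (K - (h : ℂ) • (Δ + Δᴴ))) * Yᴴ)).re ≤ d) :
    h * c ^ 2 / d ≤ ((K - (h : ℂ) • (Δ + Δᴴ)).groundStateFunctional (Δ + Δᴴ)).re := by
  have hwb := ward_bogoliubov_groundStateFunctional hK hG hKG hch hh Y
  set o := ((K - (h : ℂ) • (Δ + Δᴴ)).groundStateFunctional (Δ + Δᴴ)).re with ho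
  set dd := ((K - (h : ℂ) • (Δ + Δᴴ)).groundStateFunctional
          (Yᴴ * ((K - (h : ℂ) • (Δ + Δᴴ)) * Y - Y * (K - (h : ℂ) • (Δ + Δᴴ))) -
            ((K - (h : ℂ) • (Δ + Δᴴ)) * Y - Y * (K - (h : ℂ) • (Δ + Δᴴ))) * Yᴴ)).re with hdd
  have hA : (K - (h : ℂ) • (Δ + Δᴴ)).IsHermitian := by
    refine hK.sub (IsHermitian.smul (isHermitian_add_transpose_self Δ) ?_)
    rw [isSelfAdjoint_iff, Complex.star_def, Complex.conj_ofReal]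
  have hdd0 : 0 ≤ dd := re_groundStateFunctional_doubleCommutator_nonneg hA Y
  have h1 : h * c ^ 2 ≤ h * ‖(K - (h : ℂ) • (Δ + Δᴴ)).groundStateFunctional ((Δ - Δᴴ) * Y - Y * (Δ - Δᴴ))‖ ^ 2 :=
    mul_le_mul_of_nonneg_left (pow_le_pow_left₀ hc.le hcle 2) hh.le
  have h2 : h * c ^ 2 ≤ o * dd := h1.trans hwb
  have hpos : 0 < h * c ^ 2 := by positivity
  have ho0 : 0 < o := by
    by_contra hneg
    have h3 : o * dd ≤ 0 := mul_nonpos_of_nonpos_of_nonneg (not_lt.1 hneg) hdd0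
    linarith
  rw [div_le_iff₀ hd]
  exact h2.trans (mul_le_mul_of_nonneg_left hdle ho0.le)

end Tracial

/-! ### §5 The pair-sourced `t–t'` Hubbard torus: the border floor on `m_L(h)` -/

section DWave

open Literature.Probability.LatticeModels

variable (L : ℕ) [NeZero L]

/-- The charge relation `GΔ_d − Δ_dG = −Δ_d` with `G = N/2` on the torus (`Δ_d N = NΔ_d + 2Δ_d`).
[cite: KomaTasaki1994, (2.16)] -/
theorem half_totalNumber_charge_pairField :
    ((2 : ℂ)⁻¹ • (totalNumber : Matrix (Finset (Orb (FermionTorus 2 L))) (Finset (Orb (FermionTorus 2 L))) ℂ)) *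
          pairField dWaveFormFactor L -
        pairField dWaveFormFactor L * ((2 : ℂ)⁻¹ • totalNumber) =
      -pairField dWaveFormFactor L := by
  have h := DWaveKT.pairField_mul_totalNumber L dWaveFormFactor
  rw [Matrix.smul_mul, Matrix.mul_smul, h, smul_add, smul_smul, ← sub_sub, sub_self, zero_sub,
    inv_mul_cancel₀ (two_ne_zero), one_smul]

/-- **Ward–Bogoliubov border on the pair-sourced torus.** For `A_L(h) = dWaveSourceTorusTT' L t' U μ h`
(`= K − h(Δ_d + Δ_dᴴ)`, `K = H_L(1,t',U) − μN` commuting with `N`), `0 < h`, the tracial ground state `ω_h` and EVERY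
matrix `Y`: `h·‖ω_h((Δ_d − Δ_dᴴ)Y − Y(Δ_d − Δ_dᴴ))‖² ≤ 2L²·m_L(h) · Re ω_h(Yᴴ[A_L(h),Y] − [A_L(h),Y]Yᴴ)`,
`m_L = dWaveSourceDensityTT'`. [cite: PitaevskiiStringari1991, §2] [cite: KomaTasaki1994, §1] -/
theorem ward_bogoliubov_dWaveSourceTorusTT' (t' U μ : ℝ) {h : ℝ} (hh : 0 < h)
    (Y : Matrix (Finset (Orb (FermionTorus 2 L))) (Finset (Orb (FermionTorus 2 L))) ℂ) :
    h * ‖(dWaveSourceTorusTT' L t' U μ h).groundStateFunctional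
        ((pairField dWaveFormFactor L - (pairField dWaveFormFactor L)ᴴ) * Y -
          Y * (pairField dWaveFormFactor L - (pairField dWaveFormFactor L)ᴴ))‖ ^ 2 ≤
      (2 * (L : ℝ) ^ 2 * dWaveSourceDensityTT' L t' U μ h) *
        ((dWaveSourceTorusTT' L t' U μ h).groundStateFunctional
          (Yᴴ * (dWaveSourceTorusTT' L t' U μ h * Y - Y * dWaveSourceTorusTT' L t' U μ h) -
            (dWaveSourceTorusTT' L t' U μ h * Y - Y * dWaveSourceTorusTT' L t' U μ h) * Yᴴ)).re := by
  have hK : (hubbardTorusTT' L 1 t' U - (μ : ℂ) • totalNumber).IsHermitian :=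
    isHermitian_hubbardTorusTT'_sub_smul_totalNumber L t' U μ
  have hG : ((2 : ℂ)⁻¹ • (totalNumber : Matrix (Finset (Orb (FermionTorus 2 L)))
      (Finset (Orb (FermionTorus 2 L))) ℂ)).IsHermitian := by
    refine IsHermitian.smul totalNumber_isHermitian ?_
    rw [isSelfAdjoint_iff, star_inv₀, Complex.star_def, ← Complex.ofReal_ofNat, Complex.conj_ofReal]
  have hKG : (hubbardTorusTT' L 1 t' U - (μ : ℂ) • totalNumber) * ((2 : ℂ)⁻¹ • totalNumber) =
      ((2 : ℂ)⁻¹ • totalNumber) * (hubbardTorusTT' L 1 t' U - (μ : ℂ) • totalNumber) := by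
    have hc : Commute (hubbardTorusTT' L 1 t' U - (μ : ℂ) • totalNumber)
        (totalNumber : Matrix (Finset (Orb (FermionTorus 2 L))) (Finset (Orb (FermionTorus 2 L))) ℂ) :=
      (hubbardTorusTT'_commute_totalNumber L 1 t' U).sub_left ((Commute.refl _).smul_left _)
    rw [Matrix.mul_smul, Matrix.smul_mul, hc.eq]
  have hwb := ward_bogoliubov_groundStateFunctional hK hG hKG (half_totalNumber_charge_pairField L) hh Y
  rw [← dWaveSourceTorusTT'_eq] at hwb
  rwa [re_groundStateFunctional_dWaveSourceTT'_op] at hwb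

/-- **BORDER FLOOR on `m_L(h)`.** Certified torque `0 < c ≤ ‖ω_h((Δ_d − Δ_dᴴ)Y − Y(Δ_d − Δ_dᴴ))‖` and certified
row ceiling `Re ω_h(Yᴴ[A_L(h),Y] − [A_L(h),Y]Yᴴ) ≤ d` (`0 < d`) for some matrix `Y` give
`h·c²/(2L²·d) ≤ m_L(h) = dWaveSourceDensityTT' L t' U μ h` (`0 < h`). The inputs are expectations in the SOURCED
tracial ground state (certifiable by sourced relaxations with first/second-order rows); a finite-`h` response floor,
T1 / W1. [cite: PitaevskiiStringari1991, §2] [cite: KomaTasaki1994, §1] -/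
theorem dWaveSourceDensityTT'_ge_of_ward_bogoliubov (t' U μ : ℝ) {h : ℝ} (hh : 0 < h)
    (Y : Matrix (Finset (Orb (FermionTorus 2 L))) (Finset (Orb (FermionTorus 2 L))) ℂ) {c d : ℝ} (hc : 0 < c)
    (hcle : c ≤ ‖(dWaveSourceTorusTT' L t' U μ h).groundStateFunctional
        ((pairField dWaveFormFactor L - (pairField dWaveFormFactor L)ᴴ) * Y -
          Y * (pairField dWaveFormFactor L - (pairField dWaveFormFactor L)ᴴ))‖)
    (hd : 0 < d)
    (hdle : ((dWaveSourceTorusTT' L t' U μ h).groundStateFunctional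
          (Yᴴ * (dWaveSourceTorusTT' L t' U μ h * Y - Y * dWaveSourceTorusTT' L t' U μ h) -
            (dWaveSourceTorusTT' L t' U μ h * Y - Y * dWaveSourceTorusTT' L t' U μ h) * Yᴴ)).re ≤ d) :
    h * c ^ 2 / (2 * (L : ℝ) ^ 2 * d) ≤ dWaveSourceDensityTT' L t' U μ h := by
  have hwb := ward_bogoliubov_dWaveSourceTorusTT' L t' U μ hh Y
  set o := dWaveSourceDensityTT' L t' U μ h with ho
  set dd := ((dWaveSourceTorusTT' L t' U μ h).groundStateFunctional
          (Yᴴ * (dWaveSourceTorusTT' L t' U μ h * Y - Y * dWaveSourceTorusTT' L t' U μ h) -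
            (dWaveSourceTorusTT' L t' U μ h * Y - Y * dWaveSourceTorusTT' L t' U μ h) * Yᴴ)).re with hdd
  have hdd0 : 0 ≤ dd := re_groundStateFunctional_doubleCommutator_nonneg (dWaveSourceTorusTT'_isHermitian L t' U μ h) Y
  have hL : (0 : ℝ) < (L : ℝ) ^ 2 := cast_sq_pos_of_neZero L
  have h1 : h * c ^ 2 ≤ h * ‖(dWaveSourceTorusTT' L t' U μ h).groundStateFunctional
        ((pairField dWaveFormFactor L - (pairField dWaveFormFactor L)ᴴ) * Y -
          Y * (pairField dWaveFormFactor L - (pairField dWaveFormFactor L)ᴴ))‖ ^ 2 :=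
    mul_le_mul_of_nonneg_left (pow_le_pow_left₀ hc.le hcle 2) hh.le
  have h2 : h * c ^ 2 ≤ (2 * (L : ℝ) ^ 2 * o) * dd := h1.trans hwb
  have hpos : 0 < h * c ^ 2 := by positivity
  have ho0 : 0 < o := by
    by_contra hneg
    have h3 : (2 * (L : ℝ) ^ 2 * o) * dd ≤ 0 :=
      mul_nonpos_of_nonpos_of_nonneg (by nlinarith [not_lt.1 hneg, hL]) hdd0
    linarith
  rw [div_le_iff₀ (by positivity)]
  calc h * c ^ 2 ≤ (2 * (L : ℝ) ^ 2 * o) * dd := h2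
    _ ≤ (2 * (L : ℝ) ^ 2 * o) * d := mul_le_mul_of_nonneg_left hdle (by positivity)
    _ = o * (2 * (L : ℝ) ^ 2 * d) := by ring

end DWave

end Summit.Ventures.CertifiedManyBodySolver.Observables

end
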